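import Summits.Ventures.PercRepro.RankLevelSetRuleQCell

/-!
# PercRepro — RULE Q AT THE TIGHT LAYER: THE CELL INEQUALITIES `RhatCell q k` BY KERNEL EVALUATION (RankLevelSetRuleQCellEvalW28Q4; night-1, gen 14)

Each theorem `rhatCell_q_k : RhatCell q k` (`∀ m ≤ q, Φ(q+k, q) ≤ R̂(q, k, m)`, RankLevelSetRuleQCell) is discharged by
`interval_cases m` and `norm_num` on the unfolded binomial sums (`Nat.choose` by its recursion; the
`Finset.Ioo`-sums as `Finset.range`-sums via `sum_Ioo_nat`). No `native_decide`, no `decide` on the rationals. With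
`hallUp_of_ncard_eq_of_rhatCell` each cell gives the UP form of C-044 at the tight layer `#E = (q+k) + q` of the cell
`(q+k, q)` for every finite matroid; the DOWN form is `hallDown_of_ncard_eq`. Cells: (4,17), (4,18), (4,19), (4,20).
Axioms: standard.
-/

namespace PercRepro

open Finset

/-- `Φ(21, 4) ≤ R̂(4, 17, 0)` (the cell `(21, 4)` at `#P = 0`), by kernel evaluation. -/
theorem rhatCell_4_17_0 : phiK (4 + 17) 4 ≤ rhat 4 17 0 := by
  simp only [rhat, phiK, mhat, sum_Ioo_nat]
  norm_num [Finset.sum_range_succ, Nat.choose, Nat.min_def]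

/-- `Φ(21, 4) ≤ R̂(4, 17, 1)` (the cell `(21, 4)` at `#P = 1`), by kernel evaluation. -/
theorem rhatCell_4_17_1 : phiK (4 + 17) 4 ≤ rhat 4 17 1 := by
  simp only [rhat, phiK, mhat, sum_Ioo_nat]
  norm_num [Finset.sum_range_succ, Nat.choose, Nat.min_def]

/-- `Φ(21, 4) ≤ R̂(4, 17, 2)` (the cell `(21, 4)` at `#P = 2`), by kernel evaluation. -/
theorem rhatCell_4_17_2 : phiK (4 + 17) 4 ≤ rhat 4 17 2 := by
  simp only [rhat, phiK, mhat, sum_Ioo_nat]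
  norm_num [Finset.sum_range_succ, Nat.choose, Nat.min_def]

/-- `Φ(21, 4) ≤ R̂(4, 17, 3)` (the cell `(21, 4)` at `#P = 3`), by kernel evaluation. -/
theorem rhatCell_4_17_3 : phiK (4 + 17) 4 ≤ rhat 4 17 3 := by
  simp only [rhat, phiK, mhat, sum_Ioo_nat]
  norm_num [Finset.sum_range_succ, Nat.choose, Nat.min_def]

/-- `Φ(21, 4) ≤ R̂(4, 17, 4)` (the cell `(21, 4)` at `#P = 4`), by kernel evaluation. -/
theorem rhatCell_4_17_4 : phiK (4 + 17) 4 ≤ rhat 4 17 4 := by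
  simp only [rhat, phiK, mhat, sum_Ioo_nat]
  norm_num [Finset.sum_range_succ, Nat.choose, Nat.min_def]

/-- The cell `(21, 4)` (`q = 4`, `k = 17`): `Φ(21, 4) ≤ R̂(4, 17, m)` for every `m ≤ 4`. -/
theorem rhatCell_4_17 : RhatCell 4 17 := by
  intro m hm
  interval_cases m
  · exact rhatCell_4_17_0
  · exact rhatCell_4_17_1
  · exact rhatCell_4_17_2
  · exact rhatCell_4_17_3
  · exact rhatCell_4_17_4

/-- `Φ(22, 4) ≤ R̂(4, 18, 0)` (the cell `(22, 4)` at `#P = 0`), by kernel evaluation. -/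
theorem rhatCell_4_18_0 : phiK (4 + 18) 4 ≤ rhat 4 18 0 := by
  simp only [rhat, phiK, mhat, sum_Ioo_nat]
  norm_num [Finset.sum_range_succ, Nat.choose, Nat.min_def]

/-- `Φ(22, 4) ≤ R̂(4, 18, 1)` (the cell `(22, 4)` at `#P = 1`), by kernel evaluation. -/
theorem rhatCell_4_18_1 : phiK (4 + 18) 4 ≤ rhat 4 18 1 := by
  simp only [rhat, phiK, mhat, sum_Ioo_nat]
  norm_num [Finset.sum_range_succ, Nat.choose, Nat.min_def]

/-- `Φ(22, 4) ≤ R̂(4, 18, 2)` (the cell `(22, 4)` at `#P = 2`), by kernel evaluation. -/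
theorem rhatCell_4_18_2 : phiK (4 + 18) 4 ≤ rhat 4 18 2 := by
  simp only [rhat, phiK, mhat, sum_Ioo_nat]
  norm_num [Finset.sum_range_succ, Nat.choose, Nat.min_def]

/-- `Φ(22, 4) ≤ R̂(4, 18, 3)` (the cell `(22, 4)` at `#P = 3`), by kernel evaluation. -/
theorem rhatCell_4_18_3 : phiK (4 + 18) 4 ≤ rhat 4 18 3 := by
  simp only [rhat, phiK, mhat, sum_Ioo_nat]
  norm_num [Finset.sum_range_succ, Nat.choose, Nat.min_def]

/-- `Φ(22, 4) ≤ R̂(4, 18, 4)` (the cell `(22, 4)` at `#P = 4`), by kernel evaluation. -/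
theorem rhatCell_4_18_4 : phiK (4 + 18) 4 ≤ rhat 4 18 4 := by
  simp only [rhat, phiK, mhat, sum_Ioo_nat]
  norm_num [Finset.sum_range_succ, Nat.choose, Nat.min_def]

/-- The cell `(22, 4)` (`q = 4`, `k = 18`): `Φ(22, 4) ≤ R̂(4, 18, m)` for every `m ≤ 4`. -/
theorem rhatCell_4_18 : RhatCell 4 18 := by
  intro m hm
  interval_cases m
  · exact rhatCell_4_18_0
  · exact rhatCell_4_18_1
  · exact rhatCell_4_18_2
  · exact rhatCell_4_18_3
  · exact rhatCell_4_18_4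

/-- `Φ(23, 4) ≤ R̂(4, 19, 0)` (the cell `(23, 4)` at `#P = 0`), by kernel evaluation. -/
theorem rhatCell_4_19_0 : phiK (4 + 19) 4 ≤ rhat 4 19 0 := by
  simp only [rhat, phiK, mhat, sum_Ioo_nat]
  norm_num [Finset.sum_range_succ, Nat.choose, Nat.min_def]

/-- `Φ(23, 4) ≤ R̂(4, 19, 1)` (the cell `(23, 4)` at `#P = 1`), by kernel evaluation. -/
theorem rhatCell_4_19_1 : phiK (4 + 19) 4 ≤ rhat 4 19 1 := by
  simp only [rhat, phiK, mhat, sum_Ioo_nat]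
  norm_num [Finset.sum_range_succ, Nat.choose, Nat.min_def]

/-- `Φ(23, 4) ≤ R̂(4, 19, 2)` (the cell `(23, 4)` at `#P = 2`), by kernel evaluation. -/
theorem rhatCell_4_19_2 : phiK (4 + 19) 4 ≤ rhat 4 19 2 := by
  simp only [rhat, phiK, mhat, sum_Ioo_nat]
  norm_num [Finset.sum_range_succ, Nat.choose, Nat.min_def]

/-- `Φ(23, 4) ≤ R̂(4, 19, 3)` (the cell `(23, 4)` at `#P = 3`), by kernel evaluation. -/
theorem rhatCell_4_19_3 : phiK (4 + 19) 4 ≤ rhat 4 19 3 := by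
  simp only [rhat, phiK, mhat, sum_Ioo_nat]
  norm_num [Finset.sum_range_succ, Nat.choose, Nat.min_def]

/-- `Φ(23, 4) ≤ R̂(4, 19, 4)` (the cell `(23, 4)` at `#P = 4`), by kernel evaluation. -/
theorem rhatCell_4_19_4 : phiK (4 + 19) 4 ≤ rhat 4 19 4 := by
  simp only [rhat, phiK, mhat, sum_Ioo_nat]
  norm_num [Finset.sum_range_succ, Nat.choose, Nat.min_def]

/-- The cell `(23, 4)` (`q = 4`, `k = 19`): `Φ(23, 4) ≤ R̂(4, 19, m)` for every `m ≤ 4`. -/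
theorem rhatCell_4_19 : RhatCell 4 19 := by
  intro m hm
  interval_cases m
  · exact rhatCell_4_19_0
  · exact rhatCell_4_19_1
  · exact rhatCell_4_19_2
  · exact rhatCell_4_19_3
  · exact rhatCell_4_19_4

/-- `Φ(24, 4) ≤ R̂(4, 20, 0)` (the cell `(24, 4)` at `#P = 0`), by kernel evaluation. -/
theorem rhatCell_4_20_0 : phiK (4 + 20) 4 ≤ rhat 4 20 0 := by
  simp only [rhat, phiK, mhat, sum_Ioo_nat]
  norm_num [Finset.sum_range_succ, Nat.choose, Nat.min_def]

/-- `Φ(24, 4) ≤ R̂(4, 20, 1)` (the cell `(24, 4)` at `#P = 1`), by kernel evaluation. -/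
theorem rhatCell_4_20_1 : phiK (4 + 20) 4 ≤ rhat 4 20 1 := by
  simp only [rhat, phiK, mhat, sum_Ioo_nat]
  norm_num [Finset.sum_range_succ, Nat.choose, Nat.min_def]

/-- `Φ(24, 4) ≤ R̂(4, 20, 2)` (the cell `(24, 4)` at `#P = 2`), by kernel evaluation. -/
theorem rhatCell_4_20_2 : phiK (4 + 20) 4 ≤ rhat 4 20 2 := by
  simp only [rhat, phiK, mhat, sum_Ioo_nat]
  norm_num [Finset.sum_range_succ, Nat.choose, Nat.min_def]

/-- `Φ(24, 4) ≤ R̂(4, 20, 3)` (the cell `(24, 4)` at `#P = 3`), by kernel evaluation. -/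
theorem rhatCell_4_20_3 : phiK (4 + 20) 4 ≤ rhat 4 20 3 := by
  simp only [rhat, phiK, mhat, sum_Ioo_nat]
  norm_num [Finset.sum_range_succ, Nat.choose, Nat.min_def]

/-- `Φ(24, 4) ≤ R̂(4, 20, 4)` (the cell `(24, 4)` at `#P = 4`), by kernel evaluation. -/
theorem rhatCell_4_20_4 : phiK (4 + 20) 4 ≤ rhat 4 20 4 := by
  simp only [rhat, phiK, mhat, sum_Ioo_nat]
  norm_num [Finset.sum_range_succ, Nat.choose, Nat.min_def]

/-- The cell `(24, 4)` (`q = 4`, `k = 20`): `Φ(24, 4) ≤ R̂(4, 20, m)` for every `m ≤ 4`. -/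
theorem rhatCell_4_20 : RhatCell 4 20 := by
  intro m hm
  interval_cases m
  · exact rhatCell_4_20_0
  · exact rhatCell_4_20_1
  · exact rhatCell_4_20_2
  · exact rhatCell_4_20_3
  · exact rhatCell_4_20_4

end PercRepro
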